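import Summits.ResolutionOfSingularities.ResolutionOfSingularities.Theorems.EquisingularLiftEquisingularLiftNatP1VBLiftSection
import Mathlib.RingTheory.Nakayama
import HarnessLib

/-!
# [OURS · L1 W4.5(b) · LINE (T-j)-PROOF, BRICK E] H⁰-lifting over a principal kernel on ANY affine cover:
# `Ȟ¹(g⁻¹𝒰; g^*F) = 0 ⇒ Γ(X, F) → Γ(X ×_A B, g^*F)` is onto (proper `X/A`, `A` Noetherian local, `ker (A → B) ⊆ (ϖ)`)

Cell res-hironaka, LADDER-RESOLUTION rung L, slot W4.5(b), crux chain w45b: EL♮(3) = stmt-ResolutionOfSingularities-20148,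
residue (T-j) = F-102 `Literature.AlgebraicGeometry.Resolution.GenusZeroOverCompleteDVR` (LINE (T-j)-PROOF, res-L1-w45b-lead-2 g3,
FACT CLAIM #1; skeleton `L/res-L1-w45b-lead-2/F102Skeleton.lean`, brick E). `--supports stmt-ResolutionOfSingularities-20148 --as
helper`. NOT a statement of any manuscript; OURS; AI-written, weaker than expert review. No `sorry`; standard axioms; DEF-FREE
apart from no definitions at all (the cochain maps are written inline).

THEOREM (`exists_unitSection_eq_of_ker_le_span`) — res-type-027's T-P1VB part 2b `exists_unitSection_eq` (…NatP1VBLiftSection) WITHOUT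
the two-chart hypothesis, for a principal kernel: `A` Noetherian local, `φ : A ↠ B`, `B ≠ 0`, `ϖ ∈ ker φ ⊆ (ϖ)` (e.g. a discrete
valuation ring onto its residue field, `ϖ` a uniformiser); `f : X → Spec A` proper, `g : Y → X` the base change of `Spec φ`
(`IsPullback g t f (Spec φ)`); `𝒰 = (U_i)_{i ∈ ι}` a cover of `X` by AFFINE opens with AFFINE pairwise intersections (any index type);
`F` a vector bundle on `X` whose sections over the triple intersections `U_i ∩ U_j ∩ U_l` have no `ϖ`-torsion (e.g. `X` flat over a
domain `A`); and `Ȟ¹(g⁻¹𝒰; g^*F) = 0`. THEN every global section of `g^*F` is `η(s)` for a global section `s` of `F`.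

PROOF (no `H²`, no two-chart trick). (A) `exists_sub_smul_mem_cechMB1`: a `1`-cocycle `z` of `F` on `𝒰` restricts to a cocycle of
`g^*F` on `g⁻¹𝒰`, a coboundary `d⁰b̄` by hypothesis; lifting `b̄ = η(b)` chartwise (part 1: `η` is onto over affines), `z − d⁰b` dies
downstairs on the affine `U_i ∩ U_j`, so lies in `(ker φ)Γ ⊆ ϖΓ` (part 1): `z − d⁰b = ϖ z′`, and `z′` IS A COCYCLE because
`ϖ d¹z′ = d¹(z − d⁰b) = 0` and `ϖ` is a non-zero-divisor on `Č²`. So `Ȟ¹(𝒰;F) = ϖ Ȟ¹(𝒰;F)`. (B) `cechMZ1_le_cechMB1`: `Ȟ¹(𝒰;F)` is a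
finite `A`-module (the tree's dévissage `Morphisms/Devissage` + `DevissageHeart.heart_holds` + `CohOfVectorBundle`, `f` proper) and
`(ϖ) ⊆ ker φ ⊆ 𝔪_A`, so Nakayama gives `Ȟ¹(𝒰;F) = 0`. (C) `exists_unitSection_eq_of_ker_le_span`: lift `s₀` chartwise to `a_i`;
`d⁰a` dies downstairs, so `d⁰a = ϖ e` with `e` a cocycle (as in (A)), `e = d⁰h` by (B), and `a − ϖ h` is a `0`-cocycle gluing to
`s` with `η(s) = s₀` (`η(ϖ h_i) = 0`).
-/

noncomputable section

open CategoryTheory AlgebraicGeometry TopologicalSpace Opposite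
open Literature.AlgebraicGeometry.Morphisms Literature.AlgebraicGeometry.Modules Literature.AlgebraicGeometry

universe u v

set_option linter.dupNamespace false -- mandated namespace `Summit.<Summit>.<Problem>` of this single-conjunct summit

namespace Summit.ResolutionOfSingularities.ResolutionOfSingularities.Cruxes.EquisingularLiftNat.P1VB

variable {A : Type u} [CommRing A] {X : Scheme.{u}} (f : X ⟶ Spec (.of A)) {ι : Type v} (U : ι → X.Opens)
  {B : Type u} [CommRing B] (φ : A →+* B) {Y : Scheme.{u}} {g : Y ⟶ X} {t : Y ⟶ Spec (.of B)} (F : X.Modules)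

/-! ### The pull-back of cochains commutes with the Čech differentials -/

/-- `η` commutes with `d⁰`: `η((d⁰b)_{ij}) = (d⁰ η(b))_{ij}`. [folklore] -/
theorem unitSection_cechMD0 (b : CechMC0 f F U) (i j : ι) :
    unitSection g F (U i ⊓ U j) (cechMD0 f F U b i j) =
      cechMD0 t ((Scheme.Modules.pullback g).obj F) (fun i => g ⁻¹ᵁ U i)
        (fun i => unitSection g F (U i) (b i)) i j := by
  rw [cechMD0_apply, cechMD0_apply, unitSection_sub, unitSection_res f (t := t), unitSection_res f (t := t)]
  rfl

/-- `η` commutes with `d¹`: `η((d¹c)_{ijl}) = (d¹ η(c))_{ijl}`. [folklore] -/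
theorem unitSection_cechMD1 (c : CechMC1 f F U) (i j l : ι) :
    unitSection g F (U i ⊓ U j ⊓ U l) (cechMD1 f F U c i j l) =
      cechMD1 t ((Scheme.Modules.pullback g).obj F) (fun i => g ⁻¹ᵁ U i)
        (fun i j => unitSection g F (U i ⊓ U j) (c i j)) i j l := by
  rw [cechMD1_apply, cechMD1_apply]
  have hadd : ∀ x y : MSections f F (U i ⊓ U j ⊓ U l),
      unitSection g F (U i ⊓ U j ⊓ U l) ((x + y : MSections f F (U i ⊓ U j ⊓ U l))) =
        unitSection g F (U i ⊓ U j ⊓ U l) x + unitSection g F (U i ⊓ U j ⊓ U l) y :=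
    fun x y => map_add ((pullbackUnit g F).app (U i ⊓ U j ⊓ U l)).hom x y
  erw [hadd, unitSection_sub, unitSection_res f (t := t), unitSection_res f (t := t), unitSection_res f (t := t)]
  rfl

/-- A cochain all of whose components are `ϖ`-multiples is `ϖ` times a cochain. [folklore] -/
theorem exists_eq_smul_of_forall_mem (ϖ : A) {c : CechMC1 f F U}
    (h : ∀ i j, c i j ∈ Ideal.span {ϖ} • (⊤ : Submodule A (MSections f F (U i ⊓ U j)))) :
    ∃ c' : CechMC1 f F U, c = ϖ • c' := by
  have h' : ∀ i j, ∃ m : MSections f F (U i ⊓ U j), c i j = ϖ • m := fun i j => by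
    have h1 := h i j
    rw [Submodule.ideal_span_singleton_smul] at h1
    obtain ⟨m, -, hm⟩ := (Submodule.mem_smul_pointwise_iff_exists _ _ _).mp h1
    exact ⟨m, hm.symm⟩
  choose c' hc' using h'
  exact ⟨c', funext fun i => funext fun j => hc' i j⟩

section Core

/-- **A cochain dying downstairs is `ϖ` times a cochain; if it is a cocycle, so is the quotient.** For `c ∈ Č¹(𝒰, F)` with
`η(c_{ij}) = 0` for all `i, j`: `c = ϖ c′` (part 1 on the affine `U_i ∩ U_j`: the kernel of `η` is `(ker φ)Γ ⊆ ϖΓ`), and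
`d¹c = 0 ⇒ d¹c′ = 0` (`ϖ` is a non-zero-divisor on `Č²`). [OURS] -/
theorem exists_eq_smul_cocycle_of_unitSection_eq_zero (hφ : Function.Surjective φ) (ϖ : A)
    (hker : RingHom.ker φ ≤ Ideal.span {ϖ}) (H : IsPullback g t f (Spec.map (CommRingCat.ofHom φ)))
    (hloc : IsAffineLocalizing F) (hUU : ∀ i j, IsAffineOpen (U i ⊓ U j))
    (htf : ∀ (i j l : ι) (m : MSections f F (U i ⊓ U j ⊓ U l)), ϖ • m = 0 → m = 0) {c : CechMC1 f F U}
    (hc0 : ∀ i j, unitSection g F (U i ⊓ U j) (c i j) = 0) (hc : c ∈ cechMZ1 f F U) :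
    ∃ c' : CechMC1 f F U, c' ∈ cechMZ1 f F U ∧ c = ϖ • c' := by
  obtain ⟨c', rfl⟩ := exists_eq_smul_of_forall_mem f U F ϖ (c := c) fun i j =>
    Submodule.smul_mono hker le_rfl
      ((unitSection_eq_zero_iff_mem_smul_top φ f hφ H F hloc (hUU i j) (c i j)).mp (hc0 i j))
  refine ⟨c', ?_, rfl⟩
  rw [mem_cechMZ1_iff] at hc ⊢
  rw [map_smul] at hc
  funext i j l
  exact htf i j l _ (by simpa using congrFun (congrFun (congrFun hc i) j) l)

/-- **(A) `Ȟ¹(𝒰;F) = ϖ Ȟ¹(𝒰;F)` when `Ȟ¹(g⁻¹𝒰; g^*F) = 0`**: every `1`-cocycle `z` of `F` on `𝒰` is `d⁰b + ϖ z′` with `z′` a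
cocycle. [OURS] -/
theorem exists_sub_smul_mem_cechMB1 (hφ : Function.Surjective φ) (ϖ : A)
    (hker : RingHom.ker φ ≤ Ideal.span {ϖ}) (H : IsPullback g t f (Spec.map (CommRingCat.ofHom φ)))
    (hloc : IsAffineLocalizing F) (hU : ∀ i, IsAffineOpen (U i)) (hUU : ∀ i j, IsAffineOpen (U i ⊓ U j))
    (htf : ∀ (i j l : ι) (m : MSections f F (U i ⊓ U j ⊓ U l)), ϖ • m = 0 → m = 0)
    (h1 : Subsingleton (CechMH1 t ((Scheme.Modules.pullback g).obj F) (fun i => g ⁻¹ᵁ U i)))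
    {z : CechMC1 f F U} (hz : z ∈ cechMZ1 f F U) :
    ∃ z' : CechMC1 f F U, z' ∈ cechMZ1 f F U ∧ z - ϖ • z' ∈ cechMB1 f F U := by
  haveI := h1
  -- `η(z)` is a cocycle downstairs, hence a coboundary `d⁰ b̄`
  set ηz : CechMC1 t ((Scheme.Modules.pullback g).obj F) (fun i => g ⁻¹ᵁ U i) :=
    fun i j => unitSection g F (U i ⊓ U j) (z i j) with hηz
  have hηz1 : ηz ∈ cechMZ1 t ((Scheme.Modules.pullback g).obj F) (fun i => g ⁻¹ᵁ U i) := by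
    rw [mem_cechMZ1_iff]
    funext i j l
    have h := unitSection_cechMD1 f U F (t := t) (g := g) z i j l
    rw [(mem_cechMZ1_iff f F U z).mp hz] at h
    have h0 : unitSection g F (U i ⊓ U j ⊓ U l) ((0 : CechMC2 f F U) i j l) = 0 :=
      map_zero ((pullbackUnit g F).app (U i ⊓ U j ⊓ U l)).hom
    rw [h0] at h
    exact h.symm
  have hηB : ηz ∈ cechMB1 t ((Scheme.Modules.pullback g).obj F) (fun i => g ⁻¹ᵁ U i) :=
    (CechMH1.mk_eq_zero_iff t _ _ ⟨ηz, hηz1⟩).mp (Subsingleton.elim _ _)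
  obtain ⟨bbar, hbbar⟩ := (mem_cechMB1_iff t _ _ ηz).mp hηB
  -- lift `b̄` chartwise
  choose b hb using fun i => unitSection_surjective_of_isPullback φ f hφ H F hloc (hU i) (bbar i)
  -- `z - d⁰ b` dies downstairs, so it is `ϖ z′` with `z′` a cocycle
  have hdiff : ∀ i j, unitSection g F (U i ⊓ U j) ((z - cechMD0 f F U b) i j) = 0 := fun i j => by
    change unitSection g F (U i ⊓ U j) (z i j - cechMD0 f F U b i j) = 0
    rw [unitSection_sub, unitSection_cechMD0 f U F (t := t)]
    have hb' : (fun i => unitSection g F (U i) (b i)) = bbar := funext hb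
    rw [hb', hbbar, sub_self]
  have hzb : z - cechMD0 f F U b ∈ cechMZ1 f F U :=
    Submodule.sub_mem _ hz (cechMB1_le_cechMZ1 f F U ((mem_cechMB1_iff f F U _).mpr ⟨b, rfl⟩))
  obtain ⟨z', hz', hzz'⟩ := exists_eq_smul_cocycle_of_unitSection_eq_zero f U φ F hφ ϖ hker H hloc hUU htf hdiff hzb
  refine ⟨z', hz', (mem_cechMB1_iff f F U _).mpr ⟨b, ?_⟩⟩
  rw [← hzz', sub_sub_cancel]

/-- **(B) `Ȟ¹(𝒰;F) = 0`**: with `F` a vector bundle and `𝒰` covering the proper `X`, `Ȟ¹(𝒰;F)` is a finite `A`-module (dévissage)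
equal to `ϖ` times itself, and `ϖ ∈ ker φ ⊆ 𝔪_A` — Nakayama. [OURS] -/
theorem cechMZ1_le_cechMB1 [IsNoetherianRing A] [IsLocalRing A] [Nontrivial B] [IsProper f]
    (hφ : Function.Surjective φ) (ϖ : A) (hϖ : ϖ ∈ RingHom.ker φ)
    (hker : RingHom.ker φ ≤ Ideal.span {ϖ}) (H : IsPullback g t f (Spec.map (CommRingCat.ofHom φ)))
    (hU : ∀ i, IsAffineOpen (U i)) (hUU : ∀ i j, IsAffineOpen (U i ⊓ U j))
    (htf : ∀ (i j l : ι) (m : MSections f F (U i ⊓ U j ⊓ U l)), ϖ • m = 0 → m = 0)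
    (hF : Motives.IsVectorBundle F) (hcov : ⨆ i, U i = ⊤)
    (h1 : Subsingleton (CechMH1 t ((Scheme.Modules.pullback g).obj F) (fun i => g ⁻¹ᵁ U i))) :
    cechMZ1 f F U ≤ cechMB1 f F U := by
  haveI : IsLocallyNoetherian X := LocallyOfFiniteType.isLocallyNoetherian f
  haveI : CompactSpace X := QuasiCompact.compactSpace_of_compactSpace f
  have hK : InK f U F := devissage hU (heart_holds f hU hcov) F (coh_of_isVectorBundle hF)
  haveI := hK.finite_H1
  -- `Ȟ¹ = (ϖ) Ȟ¹`
  have hle : (⊤ : Submodule A (CechMH1 f F U)) ≤ Ideal.span {ϖ} • ⊤ := by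
    rintro q -
    obtain ⟨⟨z, hz⟩, rfl⟩ := CechMH1.mk_surjective f F U q
    obtain ⟨z', hz', hzz'⟩ :=
      exists_sub_smul_mem_cechMB1 f U φ F hφ ϖ hker H (coh_of_isVectorBundle hF).loc hU hUU htf h1 hz
    have hq : CechMH1.mk f F U ⟨z, hz⟩ = ϖ • CechMH1.mk f F U ⟨z', hz'⟩ := by
      rw [← sub_eq_zero, ← map_smul, ← map_sub, CechMH1.mk_eq_zero_iff]
      exact hzz'
    rw [hq]
    exact Submodule.smul_mem_smul (Ideal.mem_span_singleton_self ϖ) Submodule.mem_top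
  have hjac : Ideal.span {ϖ} ≤ (⊥ : Ideal A).jacobson :=
    ((Ideal.span_singleton_le_iff_mem _).mpr hϖ).trans (ker_le_jacobson_bot φ)
  have hbot := Submodule.eq_bot_of_le_smul_of_le_jacobson_bot (Ideal.span {ϖ})
    (⊤ : Submodule A (CechMH1 f F U)) Module.Finite.fg_top hle hjac
  intro z hz
  rw [← CechMH1.mk_eq_zero_iff f F U ⟨z, hz⟩, ← Submodule.mem_bot A, ← hbot]
  trivial

/-- **BRICK E — sections lift when `Ȟ¹` of the reduction vanishes, on ANY affine cover, over a principal kernel.** `A` Noetherian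
local, `φ : A ↠ B ≠ 0` with `ϖ ∈ ker φ ⊆ (ϖ)`; `f : X → Spec A` proper, `g` the base change of `Spec φ`; `𝒰` a cover of `X` by
affine opens with affine pairwise intersections; `F` a vector bundle on `X` with `ϖ`-torsion-free sections on the triple
intersections; `Ȟ¹(g⁻¹𝒰; g^*F) = 0`. Then `Γ(X, F) → Γ(Y, g^*F)`, `s ↦ η(s)`, is onto. [OURS] -/
theorem exists_unitSection_eq_of_ker_le_span [IsNoetherianRing A] [IsLocalRing A] [Nontrivial B] [IsProper f]
    (hφ : Function.Surjective φ) (ϖ : A) (hϖ : ϖ ∈ RingHom.ker φ) (hker : RingHom.ker φ ≤ Ideal.span {ϖ})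
    (H : IsPullback g t f (Spec.map (CommRingCat.ofHom φ))) (hF : Motives.IsVectorBundle F)
    (hU : ∀ i, IsAffineOpen (U i)) (hUU : ∀ i j, IsAffineOpen (U i ⊓ U j)) (hcov : ⨆ i, U i = ⊤)
    (htf : ∀ (i j l : ι) (m : MSections f F (U i ⊓ U j ⊓ U l)), ϖ • m = 0 → m = 0)
    (h1 : Subsingleton (CechMH1 t ((Scheme.Modules.pullback g).obj F) (fun i => g ⁻¹ᵁ U i)))
    (s₀ : Γ((Scheme.Modules.pullback g).obj F, g ⁻¹ᵁ ⊤)) :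
    ∃ s : Γ(F, ⊤), unitSection g F ⊤ s = s₀ := by
  have hloc : IsAffineLocalizing F := (coh_of_isVectorBundle hF).loc
  -- lift `s₀` chartwise
  choose a₀ ha₀ using fun i => unitSection_surjective_of_isPullback φ f hφ H F hloc (hU i)
    (MSections.res t ((Scheme.Modules.pullback g).obj F) (Scheme.Hom.preimage_mono g le_top)
      (s₀ : MSections t ((Scheme.Modules.pullback g).obj F) (g ⁻¹ᵁ ⊤)))
  let a : CechMC0 f F U := fun i => a₀ i
  have ha : ∀ i, unitSection g F (U i) (a i) =
      MSections.res t ((Scheme.Modules.pullback g).obj F) (Scheme.Hom.preimage_mono g le_top)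
        (s₀ : MSections t ((Scheme.Modules.pullback g).obj F) (g ⁻¹ᵁ ⊤)) := ha₀
  -- `d⁰ a` dies downstairs, so `d⁰ a = ϖ e` with `e` a cocycle
  have hd0 : ∀ i j, unitSection g F (U i ⊓ U j) (cechMD0 f F U a i j) = 0 := fun i j => by
    rw [unitSection_cechMD0 f U F (t := t)]
    show cechMD0 t ((Scheme.Modules.pullback g).obj F) (fun i => g ⁻¹ᵁ U i) (fun i => unitSection g F (U i) (a i)) i j =
      (0 : MSections t ((Scheme.Modules.pullback g).obj F) ((fun i => g ⁻¹ᵁ U i) i ⊓ (fun i => g ⁻¹ᵁ U i) j))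
    rw [cechMD0_apply, sub_eq_zero]
    change MSections.res t _ _ (unitSection g F (U j) (a j)) = MSections.res t _ _ (unitSection g F (U i) (a i))
    rw [ha, ha, MSections.res_res, MSections.res_res]
  obtain ⟨e, he, hae⟩ := exists_eq_smul_cocycle_of_unitSection_eq_zero f U φ F hφ ϖ hker H hloc hUU htf hd0
    (cechMB1_le_cechMZ1 f F U ((mem_cechMB1_iff f F U _).mpr ⟨a, rfl⟩))
  -- `e` is a coboundary `d⁰ h`
  obtain ⟨h, hh⟩ := (mem_cechMB1_iff f F U e).mp
    (cechMZ1_le_cechMB1 f U φ F hφ ϖ hϖ hker H hU hUU htf hF hcov h1 he)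
  -- `a - ϖ h` is a `0`-cocycle: glue it
  have hab : a - ϖ • h ∈ cechMH0 f F U := by
    rw [cechMH0, LinearMap.mem_ker, map_sub, map_smul, hh, ← hae, sub_self]
  refine ⟨(cechMH0EquivSections f U F hcov).symm ⟨a - ϖ • h, hab⟩, ?_⟩
  have hres : ∀ i, MSections.res f F (le_top : U i ≤ ⊤)
      ((cechMH0EquivSections f U F hcov).symm ⟨a - ϖ • h, hab⟩) = a i - ϖ • h i := fun i =>
    congrFun (congrArg Subtype.val ((cechMH0EquivSections f U F hcov).apply_symm_apply ⟨a - ϖ • h, hab⟩)) i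
  have hϖ0 : ∀ i, unitSection g F (U i) (ϖ • h i) = 0 := fun i =>
    (unitSection_eq_zero_iff_mem_smul_top φ f hφ H F hloc (hU i) _).mpr
      (Submodule.smul_mem_smul hϖ Submodule.mem_top)
  -- compare on the cover `g⁻¹U_i` of `Y`
  refine MSections.eq_of_res_eq t ((Scheme.Modules.pullback g).obj F) (fun i => g ⁻¹ᵁ U i)
    (fun i => Scheme.Hom.preimage_mono g le_top) (by rw [← Scheme.Hom.preimage_iSup, hcov]) fun i => ?_
  change MSections.res t ((Scheme.Modules.pullback g).obj F) _ (unitSection g F ⊤ _) = _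
  rw [← unitSection_res f (t := t) F (le_top : U i ≤ ⊤), hres, unitSection_sub, ha, hϖ0, sub_zero]

end Core

end Summit.ResolutionOfSingularities.ResolutionOfSingularities.Cruxes.EquisingularLiftNat.P1VB

end
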